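import Mathlib
import HarnessLib

/-!
# Route `WeakCouplingBCS` — certificate vocabulary for `WcbcsKohnLuttingerB1g` (stmt-HubbardSuperconductivity-0158):
# the arithmetic SPEC of the JOINT enclosure `dJ` — orientation-split entrywise Lagrange duality (Mathlib-only, PROVED)

Sibling of `Theorems/WeakCouplingBCSKlCertTPrimeJoint.lean` (§1–§2: the joint hypothesis `JointEnclosureTP`, the joint checker `checkB1gJ`, the window theorems
`kltpj_window(_U)`); this file is §3 of planner hubbard-klscan-idea-3 g17's `r17/Sketch17.lean` VERBATIM (card «orientation-split-dual», refuter
hubbard-klscan-crit-1: NEW-COMBINATION (strong) · KEEP), filed by margin-1 (g18).  It is the inequality the in-seat certified computation of `dJ` instantiates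
(margin-1 g17 `HOME/margin-1-g17/stage2j/joint2.py` / `joint2E.py` + the independent `joint_impl2.py`; refuter byte replays 7/7 + 10/10), stated and proved over `ℝ`.

Setting (per rival channel `χ`, per cell pair of E0's Fermi-curve partition; `σ` the cell weights, `t_h` the orientation-resolved table value of `χ₀(k + h k')`,
`h ∈ D₄`, with certified hull `[lo_h, hi_h]`, midpoint `mid_h`, radius `R_h = √(σσ')·(hi_h − lo_h)/2`): the far defect matrix and the `B1g` ceiling numerator are
BOTH affine in the same eight deviations `δ_h ∈ [−R_h, R_h]`.
1-D rival: `Z = m + u + v`, ceiling deviation `b(u − v)`, where `u` (`|u| ≤ Rp = Σ_{χ(h)χ_B(h)=+1} R_h`) and `v` (`|v| ≤ Rm`) aggregate the two orientation classes,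
`m = Σ_h χ(h) mid_h − 8𝔻` (`𝔻` the deflation), `b = Φ_B Φ_B'/Nhi ≥ 0` (entrywise non-negative `B1g` trial on the fundamental domain).  `E` doublet: per `C₂`-coset
`{h, C₂h}`: `Z = m + u − v` (`u = δ_h`, `v = δ_{C₂h}`, `m = mid_h − mid_{C₂h} − 2𝔻_h`), ceiling deviation `s·b(u + v)` with `s = χ_B1g(h) = χ_B1g(C₂h) ∈ {±1}`;
`HS²_E/2 = 2·Σ_cosets Z²` (a `D₄`-invariant deflation design).  The certified `dJ` is `Cμ + Σ H` (rounded up), `μ > 0` free (two implementations: the closed form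
`Hu` below, and the four-corner enumeration of the character zonotope — equal by `entry_dual_le`'s case split).
Contents: the per-entry Lagrange bound `entry_dual_le` (closed form `Hu`, three regions), its signed form `entry_dual_le_signed`, the four-corner rules
`corner_bound(_signed)`, the master Lagrange step `dual_master` (`√(C·ΣZ²) + Σℓ ≤ Cμ + ΣH`), and the two instances the rival channels need: `split_dual_le`
(1-D rivals, `C = 1`) and `coset_dual_le` (the `E` doublet, `C = 2`).
Nothing here is a record and no number is asserted; nothing here asserts a margin, `K₃`, `U₀`, the window or superconductivity; a Kohn–Luttinger `O(U²)` channel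
statement is not ODLRO and nothing here proves superconductivity in the Hubbard model.  No `sorry`, no instances, no notation.
References: S. M. Rump, Acta Numerica 19 (2010) 287–449, §10 (verified bounds for quadratic forms); S. Boyd, L. Vandenberghe, *Convex Optimization* (2004), §5.1
(Lagrange dual of a norm maximisation over a box).
-/

noncomputable section

-- the tree's namespace `Summit.<Summit>.<Problem>.Theorems` repeats the summit name by design (D-0017)
set_option linter.dupNamespace false

namespace Summit.HubbardSuperconductivity.HubbardSuperconductivity.Theorems.KlCertTPrimeJoint

namespace Galerkin

open Finset BigOperators

/-- The closed-form per-entry dual bound (three affine regions of the convex piecewise-linear box support function, each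
quadratic bounded by its vertex value). [folklore] -/
def Hu (m Rp Rm b μ : ℝ) : ℝ :=
  max (max ((m + Rp + Rm) ^ 2 / (4 * μ) + (Rp - Rm) * b)
           ((m + Rp - Rm) ^ 2 / (4 * μ) + (Rp + Rm) * b))
      ((m - Rp - Rm) ^ 2 / (4 * μ) - (Rp - Rm) * b)

/-- Box support: `u t ≤ R |t|` for `|u| ≤ R`. [folklore] -/
theorem box_term_le {u R t : ℝ} (hu : |u| ≤ R) : u * t ≤ R * |t| := by
  have h1 : u * t ≤ |u * t| := le_abs_self _
  rw [abs_mul] at h1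
  have h2 : |u| * |t| ≤ R * |t| := mul_le_mul_of_nonneg_right hu (abs_nonneg t)
  linarith

/-- A concave quadratic is bounded by its vertex value. [folklore] -/
theorem quad_le_vertex {μ : ℝ} (hμ : 0 < μ) (A C φ : ℝ) :
    A * φ + C - μ * φ ^ 2 ≤ A ^ 2 / (4 * μ) + C := by
  have h4 : 0 < 4 * μ := by linarith
  have key : A * φ - μ * φ ^ 2 ≤ A ^ 2 / (4 * μ) := by
    rw [le_div_iff₀ h4]; nlinarith [sq_nonneg (2 * μ * φ - A)]
  linarith

/-- **The per-entry Lagrange bound**: for every dual value `φ`, `m φ + u(φ + b) + v(φ − b) − μ φ² ≤ Hu m Rp Rm b μ`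
(`|u| ≤ Rp`, `|v| ≤ Rm`, `b ≥ 0`, `μ > 0`). [folklore] -/
theorem entry_dual_le {m Rp Rm b μ u v : ℝ} (hμ : 0 < μ) (hb : 0 ≤ b)
    (hu : |u| ≤ Rp) (hv : |v| ≤ Rm) (φ : ℝ) :
    m * φ + u * (φ + b) + v * (φ - b) - μ * φ ^ 2 ≤ Hu m Rp Rm b μ := by
  have h1 : u * (φ + b) ≤ Rp * |φ + b| := box_term_le hu
  have h2 : v * (φ - b) ≤ Rm * |φ - b| := box_term_le hv
  unfold Hu
  rcases le_or_gt b φ with hφ | hφ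
  · have e1 : |φ + b| = φ + b := abs_of_nonneg (by linarith)
    have e2 : |φ - b| = φ - b := abs_of_nonneg (by linarith)
    rw [e1] at h1; rw [e2] at h2
    have q := quad_le_vertex hμ (m + Rp + Rm) ((Rp - Rm) * b) φ
    have : m * φ + u * (φ + b) + v * (φ - b) - μ * φ ^ 2
        ≤ (m + Rp + Rm) ^ 2 / (4 * μ) + (Rp - Rm) * b := by nlinarith
    exact le_trans this (le_trans (le_max_left _ _) (le_max_left _ _))
  · rcases lt_or_ge φ (-b) with hφ' | hφ'
    · have e1 : |φ + b| = -(φ + b) := abs_of_neg (by linarith)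
      have e2 : |φ - b| = -(φ - b) := abs_of_neg (by linarith)
      rw [e1] at h1; rw [e2] at h2
      have q := quad_le_vertex hμ (m - Rp - Rm) (-((Rp - Rm) * b)) φ
      have : m * φ + u * (φ + b) + v * (φ - b) - μ * φ ^ 2
          ≤ (m - Rp - Rm) ^ 2 / (4 * μ) - (Rp - Rm) * b := by nlinarith
      exact le_trans this (le_max_right _ _)
    · have e1 : |φ + b| = φ + b := abs_of_nonneg (by linarith)
      have e2 : |φ - b| = -(φ - b) := abs_of_nonpos (by linarith)
      rw [e1] at h1; rw [e2] at h2
      have q := quad_le_vertex hμ (m + Rp - Rm) ((Rp + Rm) * b) φ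
      have : m * φ + u * (φ + b) + v * (φ - b) - μ * φ ^ 2
          ≤ (m + Rp - Rm) ^ 2 / (4 * μ) + (Rp + Rm) * b := by nlinarith
      exact le_trans this (le_trans (le_max_right _ _) (le_max_left _ _))

/-- **The signed per-entry bound** (the `E`-coset form): for `s = ±1`,
`ψ(m + u − v) + s·b(u + v) − ν ψ² ≤ Hu (s m) R1 R2 b ν`. [folklore] -/
theorem entry_dual_le_signed {m R1 R2 b ν u v s : ℝ} (hν : 0 < ν) (hb : 0 ≤ b) (hu : |u| ≤ R1) (hv : |v| ≤ R2)
    (hs : s = 1 ∨ s = -1) (ψ : ℝ) :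
    ψ * (m + (u - v)) + s * (b * (u + v)) - ν * ψ ^ 2 ≤ Hu (s * m) R1 R2 b ν := by
  rcases hs with rfl | rfl
  · have hv' : |(-v)| ≤ R2 := by rwa [abs_neg]
    have e := entry_dual_le (m := m) hν hb hu hv' ψ
    have h : ψ * (m + (u - v)) + 1 * (b * (u + v)) - ν * ψ ^ 2 =
        m * ψ + u * (ψ + b) + (-v) * (ψ - b) - ν * ψ ^ 2 := by ring
    rw [h, one_mul]; exact e
  · have hu' : |(-u)| ≤ R1 := by rwa [abs_neg]
    have e := entry_dual_le (m := -m) hν hb hu' hv (-ψ)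
    have h : ψ * (m + (u - v)) + (-1) * (b * (u + v)) - ν * ψ ^ 2 =
        (-m) * (-ψ) + (-u) * (-ψ + b) + v * (-ψ - b) - ν * (-ψ) ^ 2 := by ring
    rw [h, show (-1 : ℝ) * m = -m by ring]; exact e

/-- **The four-corner rule, soundness direction (margin-1 g17's engine form)**: at ANY deviations in the box the linearised per-entry
joint objective `(m + u + v)²/(4μ) + b(u − v)` is bounded by `Hu` = the maximum of its values at the corners `(Rp, Rm)`, `(Rp, −Rm)`,
`(−Rp, −Rm)` of the orientation-class rectangle (the fourth corner is dominated); with `μ = s₀/2` this is the AM–GM form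
`√X ≤ (X + s₀²)/(2s₀)` charged entrywise.  (Exactness: the corners are feasible deviations, so nothing is lost at this step.) [folklore] -/
theorem corner_bound {m Rp Rm b μ u v : ℝ} (hμ : 0 < μ) (hb : 0 ≤ b) (hu : |u| ≤ Rp) (hv : |v| ≤ Rm) :
    (m + u + v) ^ 2 / (4 * μ) + b * (u - v) ≤ Hu m Rp Rm b μ := by
  have e := entry_dual_le (m := m) hμ hb hu hv ((m + u + v) / (2 * μ))
  have hμ0 : μ ≠ 0 := hμ.ne'
  have h : m * ((m + u + v) / (2 * μ)) + u * ((m + u + v) / (2 * μ) + b) + v * ((m + u + v) / (2 * μ) - b)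
      - μ * ((m + u + v) / (2 * μ)) ^ 2 = (m + u + v) ^ 2 / (4 * μ) + b * (u - v) := by
    field_simp
    ring
  rw [h] at e
  exact e

/-- **The four-corner rule for an `E` coset** (signed form): `(m + u − v)²/(4ν) + s·b(u + v) ≤ Hu (s m) R1 R2 b ν`, `s = ±1`. [folklore] -/
theorem corner_bound_signed {m R1 R2 b ν u v s : ℝ} (hν : 0 < ν) (hb : 0 ≤ b) (hu : |u| ≤ R1) (hv : |v| ≤ R2)
    (hs : s = 1 ∨ s = -1) :
    (m + (u - v)) ^ 2 / (4 * ν) + s * (b * (u + v)) ≤ Hu (s * m) R1 R2 b ν := by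
  have e := entry_dual_le_signed (m := m) hν hb hu hv hs ((m + (u - v)) / (2 * ν))
  have hν0 : ν ≠ 0 := hν.ne'
  have h : (m + (u - v)) / (2 * ν) * (m + (u - v)) + s * (b * (u + v)) - ν * ((m + (u - v)) / (2 * ν)) ^ 2
      = (m + (u - v)) ^ 2 / (4 * ν) + s * (b * (u + v)) := by
    field_simp
    ring
  rw [h] at e
  exact e

/-- **The master Lagrange step**: if every entry obeys `ψ Z_k + ℓ_k − μ ψ² ≤ H_k` for all `ψ`, then
`√(C·Σ Z²) + Σ ℓ ≤ C μ + Σ H` (`C > 0` the dual mass: `√(C S) = sup {Σ ψ Z : Σ ψ² ≤ C}`). [folklore] -/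
theorem dual_master {κ : Type*} [Fintype κ] {C μ : ℝ} (hC : 0 < C) (hμ : 0 < μ) (Z ℓ H : κ → ℝ)
    (hent : ∀ k (ψ : ℝ), ψ * Z k + ℓ k - μ * ψ ^ 2 ≤ H k) :
    Real.sqrt (C * ∑ k, Z k ^ 2) + ∑ k, ℓ k ≤ C * μ + ∑ k, H k := by
  set S := ∑ k, Z k ^ 2 with hS
  have hS0 : 0 ≤ S := Finset.sum_nonneg fun k _ => sq_nonneg _
  have hℓ : ∑ k, ℓ k ≤ ∑ k, H k := Finset.sum_le_sum fun k _ => by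
    have h := hent k 0
    simpa using h
  have hCμ : 0 < C * μ := mul_pos hC hμ
  by_cases hSz : S = 0
  · have h0 : Real.sqrt (C * S) = 0 := by rw [hSz, mul_zero, Real.sqrt_zero]
    rw [h0]; linarith
  · have hSpos : 0 < S := lt_of_le_of_ne hS0 (Ne.symm hSz)
    have hCS : 0 < C * S := mul_pos hC hSpos
    set F := Real.sqrt (C * S) with hF
    have hFpos : 0 < F := Real.sqrt_pos.2 hCS
    have hF2 : F ^ 2 = C * S := Real.sq_sqrt hCS.le
    let ψ₀ : κ → ℝ := fun k => C * Z k / F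
    have h1 : ∑ k, ψ₀ k ^ 2 = C := by
      have e : ∑ k, ψ₀ k ^ 2 = C ^ 2 * S / F ^ 2 := by
        have t : ∀ k, ψ₀ k ^ 2 = C ^ 2 * Z k ^ 2 / F ^ 2 := fun k => by
          simp only [ψ₀]; ring
        simp only [t]
        rw [← Finset.sum_div, ← Finset.mul_sum]
      rw [e, hF2, div_eq_iff hCS.ne']; ring
    have h2 : ∑ k, ψ₀ k * Z k = F := by
      have e : ∑ k, ψ₀ k * Z k = C * S / F := by
        have t : ∀ k, ψ₀ k * Z k = C * Z k ^ 2 / F := fun k => by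
          simp only [ψ₀]; ring
        simp only [t]
        rw [← Finset.sum_div, ← Finset.mul_sum]
      rw [e, ← hF2, sq, mul_div_assoc, div_self hFpos.ne', mul_one]
    have h3 : ∑ k, (ψ₀ k * Z k + ℓ k - μ * ψ₀ k ^ 2) ≤ ∑ k, H k :=
      Finset.sum_le_sum fun k _ => hent k (ψ₀ k)
    have h4 : ∑ k, (ψ₀ k * Z k + ℓ k - μ * ψ₀ k ^ 2) = ∑ k, ψ₀ k * Z k + ∑ k, ℓ k - μ * ∑ k, ψ₀ k ^ 2 := by
      rw [Finset.sum_sub_distrib, Finset.sum_add_distrib, Finset.mul_sum]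
    rw [h4, h2, h1] at h3
    linarith [mul_comm C μ]

/-- **1-D rivals** (`A1g`, `A2g`, `B2g`; dual mass `C = 1`): `√(Σ (m + u + v)²) + Σ b(u − v) ≤ μ + Σ Hu m Rp Rm b μ` — the far defect
`√HS²` and the `B1g` ceiling deviation of the SAME table deviations, bounded JOINTLY. [folklore] -/
theorem split_dual_le {κ : Type*} [Fintype κ] {μ : ℝ} (hμ : 0 < μ) (m Rp Rm u v b : κ → ℝ)
    (hu : ∀ k, |u k| ≤ Rp k) (hv : ∀ k, |v k| ≤ Rm k) (hb : ∀ k, 0 ≤ b k) :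
    Real.sqrt (∑ k, (m k + (u k + v k)) ^ 2) + ∑ k, b k * (u k - v k)
      ≤ μ + ∑ k, Hu (m k) (Rp k) (Rm k) (b k) μ := by
  have h := dual_master (C := 1) one_pos hμ (fun k => m k + (u k + v k)) (fun k => b k * (u k - v k))
    (fun k => Hu (m k) (Rp k) (Rm k) (b k) μ) (fun k ψ => by
      have e := entry_dual_le (m := m k) hμ (hb k) (hu k) (hv k) ψ
      have t : ψ * (m k + (u k + v k)) + b k * (u k - v k) - μ * ψ ^ 2 =
          m k * ψ + u k * (ψ + b k) + v k * (ψ - b k) - μ * ψ ^ 2 := by ring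
      rw [t]; exact e)
  simpa using h

/-- **The `E` doublet** (per `C₂`-coset, dual mass `C = 2` because `√(HS²_E/2) = √(2·Σ_cosets Z²)` for a `D₄`-invariant deflation):
`√(2·Σ (m + u − v)²) + Σ s·b(u + v) ≤ 2ν + Σ Hu (s m) R1 R2 b ν`, `s = χ_B1g` of the coset. [folklore] -/
theorem coset_dual_le {κ : Type*} [Fintype κ] {ν : ℝ} (hν : 0 < ν) (m R1 R2 u v b s : κ → ℝ)
    (hu : ∀ k, |u k| ≤ R1 k) (hv : ∀ k, |v k| ≤ R2 k) (hb : ∀ k, 0 ≤ b k) (hs : ∀ k, s k = 1 ∨ s k = -1) :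
    Real.sqrt (2 * ∑ k, (m k + (u k - v k)) ^ 2) + ∑ k, s k * (b k * (u k + v k))
      ≤ 2 * ν + ∑ k, Hu (s k * m k) (R1 k) (R2 k) (b k) ν := by
  exact dual_master (C := 2) two_pos hν (fun k => m k + (u k - v k)) (fun k => s k * (b k * (u k + v k)))
    (fun k => Hu (s k * m k) (R1 k) (R2 k) (b k) ν) (fun k ψ => entry_dual_le_signed hν (hb k) (hu k) (hv k) (hs k) ψ)

/-- Sanity instance (Weyl form: pure box, no trial exposure). [folklore] -/
example (R μ : ℝ) (hμ : 0 < μ) (u φ : ℝ) (hu : |u| ≤ R) :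
    u * φ - μ * φ ^ 2 ≤ Hu 0 R 0 0 μ := by
  have h := entry_dual_le (m := 0) (Rp := R) (Rm := 0) (b := 0) (μ := μ) (u := u) (v := 0) hμ le_rfl hu
    (by simp) φ
  simpa using h

end Galerkin

end Summit.HubbardSuperconductivity.HubbardSuperconductivity.Theorems.KlCertTPrimeJoint

end
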